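import Literature.Geometry.Lorentzian.KerrConvergence
import Literature.Geometry.Lorentzian.KerrSchild
import Summits.FinalStateConjecture.FinalStateConjecture.Theorems.EIHFluxBalanceInertialRecessionLorentz

/-!
# Route ClusterCompleteness — crux `AdiabaticMultiKerrILED`, line `Sketch`: one boosted term, pointwise

Helper file for the crux `stmt-FinalStateConjecture-14310`
(`Summit.FinalStateConjecture.FinalStateConjecture.Theses.ClusterCompleteness.AdiabaticMultiKerrILED`),
closing the stub `stub_pointwiseTerm` of line `Sketch`.

The patched inverse metric of the crux is `G = η − Σᵢ χᵢ · 2Hᵢ(qᵢx) · (Λᵢℓ♯ᵢ(qᵢx)) ⊗ (Λᵢℓ♯ᵢ(qᵢx))`.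
The library's pointwise lemmas for generalised Kerr–Schild backgrounds are stated for
`g⁻¹ = η − φ l ⊗ l` with `φ ≥ 0` bounded and `l` an `η`-null vector NORMALISED by `η(l, e₀) = 1`
(i.e. `l⁰ = −1`). This file puts ONE boosted term in that form at an exterior rest-frame point `z`
(`r₊ < r(a, z)`): with `k = Λℓ♯(z)`,
`2H(z) k ⊗ k = φ₀ l₀ ⊗ l₀`, `l₀ = k / c`, `c = −k⁰ > 0`, `φ₀ = 2H c²`, and `0 ≤ φ₀ ≤ 8 (u⁰)²`
where `u = Λ e₀` is the `4`-velocity of the hole.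

Proof. `ℓ♯` is `η`-null on `{r > 0}` with `η(ℓ♯, e₀) = ℓ(e₀) = 1` (`Kerr.nullCovector_nullVector`,
`Kerr.bilin_nullVector`), and `r > r₊ = M + √(M² − a²) ≥ M > 0`. By `η`-invariance of `Λ`,
`η(k, k) = 0` and `η(k, u) = 1`. Write `η(k, u) = −k⁰u⁰ + ⟪k⃗, u⃗⟫` with `‖k⃗‖ = |k⁰|` (null) and
`‖u⃗‖² = (u⁰)² − 1 < (u⁰)²` (unit future timelike); Cauchy–Schwarz gives
`1 ≤ −k⁰u⁰ + |k⁰| ‖u⃗‖`, impossible for `k⁰ ≥ 0`, so `c = −k⁰ > 0` and then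
`1 ≥ c (u⁰ − ‖u⃗‖)`, i.e. `c ≤ u⁰ + ‖u⃗‖ ≤ 2u⁰`. Finally `H = M r³/(r⁴ + a²z₃²) ≤ M/r ≤ 1`
outside `r₊ ≥ M` (`Kerr.scalarH_le_div`), so `φ₀ = 2Hc² ≤ 8 (u⁰)²`. Special relativity folklore
(O'Neill 1983, Ch. 9, pp. 233–236; Kerr–Schild 1965, §2; Visser arXiv:0706.0622, (33)–(35)).
[folklore]
-/

noncomputable section

-- the doubled `FinalStateConjecture.FinalStateConjecture` path component trips dupNamespace
set_option linter.dupNamespace false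

open scoped InnerProductSpace
open Literature.Geometry.Lorentzian

namespace Summit.FinalStateConjecture.FinalStateConjecture.Cruxes.AdiabaticMultiKerrILED.Sketch

/-- **One boosted Kerr–Schild term is pointwise of generalised Kerr–Schild form with a normalised
null vector.** On the exterior `{r₊ < r}` of the rest frame, `2H (Λℓ♯)⊗(Λℓ♯) = φ₀ l₀ ⊗ l₀` with
`l₀ = Λℓ♯/c`, `c = −(Λℓ♯)⁰ > 0` (`ℓ♯` is past null, `Λ` orthochronous since `(Λe₀)⁰ > 0`), `η(l₀,l₀) = 0`,
`η(l₀, e₀) = 1`, and `0 ≤ φ₀ = 2Hc² ≤ Φ = 8 ((Λe₀)⁰)²` (`c ≤ 2 (Λe₀)⁰` by Cauchy–Schwarz,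
`2H ≤ 2M/r ≤ 2` outside `r₊ ≥ M`). O'Neill 1983, Ch. 9, pp. 233–236; Kerr–Schild 1965, §2;
Visser arXiv:0706.0622, (33)–(35). [folklore] -/
theorem stub_pointwiseTerm :
    ∀ (M a : ℝ) (Λ : lorentzGroup) (u : E4), u = (Λ : E4 ≃L[ℝ] E4) (E4.basisVector 0) →
      0 < M → |a| ≤ 2⁻¹ * M → 0 < u 0 →
      ∃ Φ : ℝ, 0 ≤ Φ ∧ ∀ z : E4, Kerr.rPlus M a < Kerr.radius a z →
        ∃ (φ₀ : ℝ) (l₀ : E4), 0 ≤ φ₀ ∧ φ₀ ≤ Φ ∧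
          Minkowski.bilin l₀ l₀ = 0 ∧ Minkowski.bilin l₀ (E4.basisVector 0) = 1 ∧
          ∀ μ ν, 2 * Kerr.scalarH M a z * ((Λ : E4 ≃L[ℝ] E4) (Kerr.nullVector a z)) μ *
              ((Λ : E4 ≃L[ℝ] E4) (Kerr.nullVector a z)) ν = φ₀ * l₀ μ * l₀ ν := by
  intro M a Λ u hu hM _ha hu0
  refine ⟨8 * (u 0) ^ 2, by positivity, fun z hz => ?_⟩
  -- the rest-frame point lies in `{r > 0}`: `r > r₊ ≥ M > 0`
  have hMr : M < Kerr.radius a z := by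
    have h : M ≤ Kerr.rPlus M a := by
      unfold Kerr.rPlus
      linarith [Real.sqrt_nonneg (M ^ 2 - a ^ 2)]
    exact h.trans_lt hz
  have hr : 0 < Kerr.radius a z := hM.trans hMr
  -- `η`-invariance of `Λ`
  have hinv : ∀ v w : E4, Minkowski.bilin ((Λ : E4 ≃L[ℝ] E4) v) ((Λ : E4 ≃L[ℝ] E4) w) =
      Minkowski.bilin v w := fun v w => Λ.2 v w
  set k : E4 := (Λ : E4 ≃L[ℝ] E4) (Kerr.nullVector a z) with hk
  -- `k` is null and `η(k, u) = η(ℓ♯, e₀) = ℓ(e₀) = 1`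
  have hkk : Minkowski.bilin k k = 0 := by
    rw [hk, hinv, Kerr.bilin_nullVector, Kerr.nullCovector_nullVector hr]
  have hku : Minkowski.bilin k u = 1 := by
    rw [hk, hu, hinv, Kerr.bilin_nullVector, Kerr.nullCovector_basisVector_zero]
  -- `η(k, u) = −k⁰ u⁰ + ⟪k⃗, u⃗⟫`
  have hku' : Minkowski.bilin k u = -(k 0 * u 0) + ⟪E4.spatial k, E4.spatial u⟫_ℝ := by
    rw [Minkowski.bilin_apply, PiLp.inner_apply]
    congr 1
    refine Finset.sum_congr rfl fun i _ => ?_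
    simp [E4.spatial_apply, mul_comm]
  have h1 : -(k 0 * u 0) + ⟪E4.spatial k, E4.spatial u⟫_ℝ = 1 := hku'.symm.trans hku
  -- `u` is a future unit timelike vector: `‖u⃗‖² = (u⁰)² − 1`, so `‖u⃗‖ < u⁰`
  have huu : E4.spatialNorm u ^ 2 = (u 0) ^ 2 - 1 := by
    have h := Theorems.lorentz_apply_zero_sq Λ
    rw [← hu] at h
    linarith
  have hun0 : 0 ≤ E4.spatialNorm u := E4.spatialNorm_nonneg u
  have hun : E4.spatialNorm u < u 0 := by
    refine lt_of_pow_lt_pow_left₀ 2 hu0.le ?_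
    rw [huu]
    linarith
  -- `‖k⃗‖ = |k⁰|` since `k` is null
  have hks : E4.spatialNorm k = |k 0| := by
    have h := Theorems.minkowski_bilin_self k
    rw [hkk] at h
    have h2 : E4.spatialNorm k ^ 2 = (k 0) ^ 2 := by linarith
    rw [← Real.sqrt_sq (E4.spatialNorm_nonneg k), h2, Real.sqrt_sq_eq_abs]
  -- Cauchy–Schwarz: `|⟪k⃗, u⃗⟫| ≤ |k⁰| ‖u⃗‖`
  have hCS : |⟪E4.spatial k, E4.spatial u⟫_ℝ| ≤ |k 0| * E4.spatialNorm u := by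
    rw [← hks]
    exact abs_real_inner_le_norm _ _
  -- `k⁰ < 0`
  have hk0 : k 0 < 0 := by
    by_contra h
    rw [not_lt] at h
    have ha : |k 0| = k 0 := abs_of_nonneg h
    have hs : ⟪E4.spatial k, E4.spatial u⟫_ℝ ≤ k 0 * E4.spatialNorm u := by
      rw [← ha]
      exact (le_abs_self _).trans hCS
    have hs' : k 0 * E4.spatialNorm u ≤ k 0 * u 0 := mul_le_mul_of_nonneg_left hun.le h
    linarith
  -- `c = −k⁰ > 0` and `c ≤ u⁰ + ‖u⃗‖ ≤ 2 u⁰`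
  set c : ℝ := -k 0 with hc
  have hcpos : 0 < c := by rw [hc]; linarith
  have hkc : k 0 = -c := by rw [hc, neg_neg]
  have hcle : c ≤ 2 * u 0 := by
    have ha : |k 0| = c := by rw [hkc, abs_neg, abs_of_pos hcpos]
    have hs := (abs_le.mp hCS).1
    rw [ha] at hs
    rw [hkc] at h1
    have h2 : c * (u 0 - E4.spatialNorm u) ≤ 1 := by nlinarith
    have h3 : 0 ≤ u 0 + E4.spatialNorm u := by linarith
    have h4 : c * (u 0 - E4.spatialNorm u) * (u 0 + E4.spatialNorm u) = c := by
      have : c * (u 0 - E4.spatialNorm u) * (u 0 + E4.spatialNorm u) =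
          c * ((u 0) ^ 2 - E4.spatialNorm u ^ 2) := by ring
      rw [this, huu]
      ring
    have h5 := mul_le_mul_of_nonneg_right h2 h3
    rw [h4, one_mul] at h5
    linarith
  -- `0 ≤ H ≤ 1` outside `r₊ ≥ M`
  have hH0 : 0 ≤ Kerr.scalarH M a z := Kerr.scalarH_nonneg hM.le a z
  have hH1 : Kerr.scalarH M a z ≤ 1 := by
    refine (Kerr.scalarH_le_div hM.le a hr).trans ?_
    rw [div_le_one hr]
    exact hMr.le
  -- the normalised null vector `l₀ = k / c` and coefficient `φ₀ = 2 H c²`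
  refine ⟨2 * Kerr.scalarH M a z * c ^ 2, c⁻¹ • k, by positivity, ?_, ?_, ?_, ?_⟩
  · -- `φ₀ ≤ 8 (u⁰)²`
    have e1 : 2 * Kerr.scalarH M a z * c ^ 2 ≤ 2 * c ^ 2 := by
      have := mul_le_mul_of_nonneg_right hH1 (sq_nonneg c)
      linarith
    have e2 : c ^ 2 ≤ (2 * u 0) ^ 2 := pow_le_pow_left₀ hcpos.le hcle 2
    nlinarith
  · -- `η(l₀, l₀) = c⁻² η(k, k) = 0`
    simp only [map_smul, smul_apply, smul_eq_mul, hkk, mul_zero]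
  · -- `η(l₀, e₀) = −l₀⁰ = −c⁻¹ k⁰ = 1`
    rw [Minkowski.bilin_symm, Minkowski.bilin_basisVector_zero_left, PiLp.smul_apply, smul_eq_mul,
      hkc, mul_neg, inv_mul_cancel₀ hcpos.ne', neg_neg]
  · -- `2H k^μ k^ν = (2H c²) (c⁻¹ k^μ) (c⁻¹ k^ν)`
    intro μ ν
    rw [PiLp.smul_apply, PiLp.smul_apply, smul_eq_mul, smul_eq_mul]
    field_simp

end Summit.FinalStateConjecture.FinalStateConjecture.Cruxes.AdiabaticMultiKerrILED.Sketch

end
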